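import Summits.BirchSwinnertonDyer.BirchSwinnertonDyer.Theorems.AlignedTransportAtTwoMainConjectureTransportAlignedAtTwoKilfordCopyCrossLevelSquarefreePairs
import Summits.BirchSwinnertonDyer.BirchSwinnertonDyer.Theorems.AlignedTransportAtTwoMainConjectureTransportAlignedAtTwoKilfordCopyCrossLevel
import Summits.BirchSwinnertonDyer.BirchSwinnertonDyer.Theorems.AlignedTransportAtTwoMainConjectureTransportAlignedAtTwoKilfordCopyOfPrint
import HarnessLib

/-!
# Crux C1 `MainConjectureTransportAlignedAtTwo` (stmt-BirchSwinnertonDyer-22296), line `birth`, residual (R2) `stub_lamLawKilford`, UNEQUAL conductors: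
# THE INTERMEDIATE-LEVEL REDUCTION FOR A SQUAREFREE RATIO in the crux's currency — `N(W₂) = N(W₁)·m`, `m = ∏_{q∈Q} q` prime to `N(W₁)`: the
# inline cross-level stub on this shape FROM «PLANE(2) at level `N(W₂)` for the `m`-old line» + the Kraus–Oesterlé parities `a_q(W₁)` even (`q ∣ m`)
# (width seat att-p3 g18; `--supports 22296`)

THEOREMS ONLY (no `def`, no `sorry`, no named fact). Sequel of `…KilfordCopyCrossLevelSquarefreePairs` (`sameKernel_depleted_of_sameKernel_oldLines`) in the style
of `…KilfordCopyCrossLevel` §3–§4 and `…KilfordCopyCrossLevelShapes` §2 (the case `m = q` prime). Pure bookkeeping; BSD is not proved by this; C1 is not closed by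
this; the cross-level input of (R2) is REDUCED, not discharged.

* §1 `odd_LFunction_of_dvd_conductorNorm_eq_mul`, `two_dvd_LFunction_sub_of_conductorNorm_eq_mul_coprime` — reduction-type parities along
  `N(W₂) = N(W₁)·m`: `a_q(W₂)` odd for `q ∣ m` (`q ∤ N(W₁)`, `q² ∤ m`), `a_ℓ(W₁) ≡ a_ℓ(W₂)` for `ℓ ∣ N(W₁)` prime to `m`.
* §2 **`uniformize_depleted_iff_of_oldLines_conductor`** — for `D₁, D₂` at the conductor levels, `N(W₂) = N(W₁)·∏_{q∈Q}q`, the `m`-old line `F₁`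
  (`a_n(F₁) = Σ_{T⊆Q}(∏T)·a_{n/∏T}(W₁)`), `S ⊇ Q` odd primes with `S ∖ Q ⊆` primes of `N(W₁)`, and the ONE family of parity hypotheses `a_q(W₁)` even
  (`q ∈ Q`; Kraus–Oesterlé 1992 Prop. 3 at `p = 2`): same half-kernel at level `N(W₂)` of `(c₁·y(F₁), c₂·y(f₂))` ⟹ same depleted half-kernel.
* §3 **`sameDepletedKernel_conductorMulSquarefree_of_oldLinesPlane`** — the BODY of v27's inline stub `stub_sameDepletedCopyKilfordNe` / `hCopyNe` with
  its binder `N(W₁) ≠ N(W₂)` specialised to `N(W₂) = N(W₁)·∏_{q∈Q} q` (`Q` a nonempty-or-not set of primes not dividing `N(W₁)`), from `hPlane` (PLANE(2) at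
  level `N(W₂)` for the `m`-old line, ∀-binder form) and `hKO` (`∀ q ∈ Q, Even (W₁.LFunction q)`).

References: Greenberg–Vatsal 2000 §3 [GreenbergVatsal2000]; Cremona 1997 §2.4, §2.10 [CremonaAlgorithms1997]; Kraus–Oesterlé 1992 Prop. 3 [KrausOesterle1992];
Silverman ATAEC IV.10.2 [Silverman1994]; Kilford–Wiese 2008 Question 1.9 (reading) [KilfordWiese2008].
-/

noncomputable section

-- justification: the `Summit.BirchSwinnertonDyer.BirchSwinnertonDyer.…` path repeats a component (route-file convention)
set_option linter.dupNamespace false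
set_option autoImplicit false

open scoped MatrixGroups ModularForm Classical

open CongruenceSubgroup Complex WeierstrassCurve IsDedekindDomain Polynomial
open Literature.NumberTheory.EllipticCurves Literature.NumberTheory.EllipticCurves.ModularForms
open Literature.NumberTheory.EllipticCurves.Greenberg1999
open Summit.BirchSwinnertonDyer.Rank1Residual.F1Sign2
open Summit.BirchSwinnertonDyer.BirchSwinnertonDyer.Theorems.AlignedTransportAtTwoDeltaPosCongruenceInputs (odd_LFunction_iff_hasMultiplicativeReductionAtPrime)
open Summit.BirchSwinnertonDyer.BirchSwinnertonDyer.Theorems.AlignedTransportAtTwoKilfordCopyCrossLevelTools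
open Summit.BirchSwinnertonDyer.BirchSwinnertonDyer.Theorems.AlignedTransportAtTwoKilfordCopyCrossLevelSquarefreePairs

namespace Summit.BirchSwinnertonDyer.BirchSwinnertonDyer.Theorems.AlignedTransportAtTwoKilfordCopyCrossLevelSquarefreeConductor

/-! ## §1 Reduction-type parities along `N(W₂) = N(W₁)·m` -/

/-- **`W₂` is multiplicative at `q` when `N(W₂) = N₁·m` with `q ∣ m`, `q² ∤ m`, `q ∤ N₁`**, hence `a_q(W₂)` is ODD. [cite: Silverman1994, IV.10.2 (b)] -/
theorem odd_LFunction_of_dvd_conductorNorm_eq_mul (W₂ : WeierstrassCurve ℚ) [W₂.IsElliptic] {N₁ m q : ℕ} (hq : q.Prime)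
    (hqN₁ : ¬ q ∣ N₁) (hqm : q ∣ m) (hq2m : ¬ q ^ 2 ∣ m) (hN₂ : W₂.conductorNorm ℤ = N₁ * m) : Odd (W₂.LFunction q) := by
  haveI : Fact q.Prime := ⟨hq⟩
  have hqN₂ : q ∣ W₂.conductorNorm ℤ := by rw [hN₂]; exact hqm.mul_left N₁
  rw [odd_LFunction_iff_hasMultiplicativeReductionAtPrime W₂ hq hqN₂,
    W₂.hasMultiplicativeReductionAtPrime_iff_hasMultiplicativeReductionAt_holds ⟨q, hq⟩]
  set v : HeightOneSpectrum ℤ := (Rat.HeightOneSpectrum.primesEquiv (R := ℤ)).symm ⟨q, hq⟩ with hv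
  have hgen : Rat.HeightOneSpectrum.natGenerator v = q :=
    congrArg Subtype.val ((Rat.HeightOneSpectrum.primesEquiv (R := ℤ)).apply_symm_apply ⟨q, hq⟩)
  have hbad : ¬ W₂.HasGoodReductionAt v := (natGenerator_dvd_conductorNorm_iff v W₂).mp (hgen ▸ hqN₂)
  have hnadd : ¬ W₂.HasAdditiveReductionAt v := by
    intro h
    have h2 := (natGenerator_sq_dvd_conductorNorm_iff v W₂).mpr h
    rw [hgen, hN₂] at h2
    have hcop : Nat.Coprime (q ^ 2) N₁ := (Nat.Coprime.pow_left 2 ((Nat.Prime.coprime_iff_not_dvd hq).mpr hqN₁))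
    exact hq2m (hcop.dvd_of_dvd_mul_left h2)
  rcases hasGoodReductionAt_or_hasMultiplicativeReductionAt_or_hasAdditiveReductionAt v W₂ with h | h | h
  · exact (hbad h).elim
  · exact h
  · exact (hnadd h).elim

/-- **Same reduction type at `ℓ ∣ N(W₁)` prime to `m`, when `N(W₂) = N(W₁)·m`**: `a_ℓ(W₁) ≡ a_ℓ(W₂) (mod 2)`. [cite: Silverman1994, IV.10.2] -/
theorem two_dvd_LFunction_sub_of_conductorNorm_eq_mul_coprime (W₁ W₂ : WeierstrassCurve ℚ) [W₁.IsElliptic] [W₂.IsElliptic] {m : ℕ}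
    (hN₂ : W₂.conductorNorm ℤ = W₁.conductorNorm ℤ * m) {ℓ : ℕ} (hℓ : ℓ.Prime) (hℓm : ¬ ℓ ∣ m)
    (hℓN : ℓ ∣ W₁.conductorNorm ℤ) : (2 : ℤ) ∣ W₁.LFunction ℓ - W₂.LFunction ℓ := by
  haveI : Fact ℓ.Prime := ⟨hℓ⟩
  have hℓN₂ : ℓ ∣ W₂.conductorNorm ℤ := by rw [hN₂]; exact hℓN.mul_right m
  have hcop : Nat.Coprime (ℓ ^ 2) m := ((Nat.Prime.coprime_iff_not_dvd hℓ).mpr hℓm).pow_left 2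
  set v : HeightOneSpectrum ℤ := (Rat.HeightOneSpectrum.primesEquiv (R := ℤ)).symm ⟨ℓ, hℓ⟩ with hv
  have hgen : Rat.HeightOneSpectrum.natGenerator v = ℓ :=
    congrArg Subtype.val ((Rat.HeightOneSpectrum.primesEquiv (R := ℤ)).apply_symm_apply ⟨ℓ, hℓ⟩)
  have hbad₁ : ¬ W₁.HasGoodReductionAt v := (natGenerator_dvd_conductorNorm_iff v W₁).mp (hgen ▸ hℓN)
  have hbad₂ : ¬ W₂.HasGoodReductionAt v := (natGenerator_dvd_conductorNorm_iff v W₂).mp (hgen ▸ hℓN₂)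
  have hadd : W₁.HasAdditiveReductionAt v ↔ W₂.HasAdditiveReductionAt v := by
    rw [← natGenerator_sq_dvd_conductorNorm_iff v W₁, ← natGenerator_sq_dvd_conductorNorm_iff v W₂, hN₂, hgen]
    exact ⟨fun h ↦ h.mul_right m, fun h ↦ hcop.dvd_of_dvd_mul_right h⟩
  have hmul : W₁.HasMultiplicativeReductionAtPrime ℓ ↔ W₂.HasMultiplicativeReductionAtPrime ℓ := by
    rw [W₁.hasMultiplicativeReductionAtPrime_iff_hasMultiplicativeReductionAt_holds ⟨ℓ, hℓ⟩,
      W₂.hasMultiplicativeReductionAtPrime_iff_hasMultiplicativeReductionAt_holds ⟨ℓ, hℓ⟩]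
    constructor
    · intro h₁
      rcases hasGoodReductionAt_or_hasMultiplicativeReductionAt_or_hasAdditiveReductionAt v W₂ with h | h | h
      · exact (hbad₂ h).elim
      · exact h
      · exact (h₁.not_hasAdditiveReductionAt (hadd.mpr h)).elim
    · intro h₂
      rcases hasGoodReductionAt_or_hasMultiplicativeReductionAt_or_hasAdditiveReductionAt v W₁ with h | h | h
      · exact (hbad₁ h).elim
      · exact h
      · exact (h₂.not_hasAdditiveReductionAt (hadd.mp h)).elim
  have h₁ := odd_LFunction_iff_hasMultiplicativeReductionAtPrime W₁ hℓ hℓN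
  have h₂ := odd_LFunction_iff_hasMultiplicativeReductionAtPrime W₂ hℓ hℓN₂
  have heven : Even (W₁.LFunction ℓ - W₂.LFunction ℓ) := by
    rw [Int.even_sub, ← Int.not_odd_iff_even, ← Int.not_odd_iff_even, h₁, h₂, hmul]
  exact heven.two_dvd

/-! ## §2 The reduction in the crux's currency at the conductor levels, squarefree ratio -/

/-- **The cross-level hypothesis of (R2) at the conductor levels, `N(W₂) = N(W₁)·∏_{q∈Q} q`, parities discharged except `a_q(W₁)` even (`q ∈ Q`).**
[cite: KrausOesterle1992, Prop. 3 (p. 262–263)] [cite: Silverman1994, IV.10.2] [cite: GreenbergVatsal2000, §3] [cite: CremonaAlgorithms1997, §2.4 and §2.10] -/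
theorem uniformize_depleted_iff_of_oldLines_conductor
    {W₁ W₂ : WeierstrassCurve ℚ} [W₁.IsElliptic] [W₂.IsElliptic] [NeZero (W₁.conductorNorm ℤ)] [NeZero (W₂.conductorNorm ℤ)]
    (D₁ : ModularParametrizationData W₁ (W₁.conductorNorm ℤ)) (D₂ : ModularParametrizationData W₂ (W₂.conductorNorm ℤ))
    (Q : Finset ℕ) (hQ : ∀ q ∈ Q, q.Prime) (hQN₁ : ∀ q ∈ Q, ¬ q ∣ W₁.conductorNorm ℤ)
    (hN₂ : W₂.conductorNorm ℤ = W₁.conductorNorm ℤ * ∏ q ∈ Q, q)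
    (hq₁ : ∀ q ∈ Q, Even (W₁.LFunction q))
    (S : Finset ℕ) (hS : ∀ ℓ ∈ S, ℓ.Prime) (hSodd : ∀ ℓ ∈ S, Odd ℓ) (hQS : Q ⊆ S)
    (hSN : ∀ ℓ ∈ S, ℓ ∉ Q → ℓ ∣ W₁.conductorNorm ℤ)
    (N' : ℕ) [NeZero N'] (hN' : W₂.conductorNorm ℤ * ∏ ℓ ∈ S, ℓ ^ 2 ∣ N')
    (g₁ g₂ : CuspForm (Gamma0 N') 2)
    (hg₁ : ∀ n, cuspCoeff g₁ n = if ∃ ℓ ∈ S, ℓ ∣ n then 0 else cuspCoeff D₁.f n)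
    (hg₂ : ∀ n, cuspCoeff g₂ n = if ∃ ℓ ∈ S, ℓ ∣ n then 0 else cuspCoeff D₂.f n)
    (F₁ : CuspForm (Gamma0 (W₂.conductorNorm ℤ)) 2)
    (hF₁ : ∀ n : ℕ, cuspCoeff F₁ n =
      ∑ T ∈ Q.powerset, ((∏ q ∈ T, q : ℕ) : ℂ) * (if (∏ q ∈ T, q) ∣ n then cuspCoeff D₁.f (n / ∏ q ∈ T, q) else 0))
    (hker : ∀ y ∈ periodHomology (W₂.conductorNorm ℤ),
      D₁.uniformize ((D₁.c : ℂ) * y F₁ / 2) = 0 ↔ D₂.uniformize ((D₂.c : ℂ) * y D₂.f / 2) = 0) :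
    ∀ x ∈ periodHomology N',
      D₁.uniformize ((D₁.c : ℂ) * ((((∏ ℓ ∈ S, ℓ ^ 2 : ℕ) : ℂ) * x g₁) / 2)) = 0 ↔
        D₂.uniformize ((D₂.c : ℂ) * ((((∏ ℓ ∈ S, ℓ ^ 2 : ℕ) : ℂ) * x g₂) / 2)) = 0 := by
  intro x hx
  rw [D₁.uniformize_eq_zero_iff, D₂.uniformize_eq_zero_iff, ← mul_div_assoc, ← mul_div_assoc]
  have hT₁ : ∀ (p : ℕ) (hp : p.Prime), (haveI : NeZero p := ⟨hp.ne_zero⟩; heckeT (Gamma0 (W₁.conductorNorm ℤ)) 2 p D₁.f) =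
      cuspCoeff D₁.f p • D₁.f :=
    fun p hp ↦ by haveI : NeZero p := ⟨hp.ne_zero⟩; exact D₁.isNewformOf.1.heckeT_eq_coeff_smul hp
  have hT₂ : ∀ (p : ℕ) (hp : p.Prime), (haveI : NeZero p := ⟨hp.ne_zero⟩; heckeT (Gamma0 (W₂.conductorNorm ℤ)) 2 p D₂.f) =
      cuspCoeff D₂.f p • D₂.f :=
    fun p hp ↦ by haveI : NeZero p := ⟨hp.ne_zero⟩; exact D₂.isNewformOf.1.heckeT_eq_coeff_smul hp
  have hdvdQ : ∀ ℓ : ℕ, ℓ.Prime → ℓ ∉ Q → ¬ ℓ ∣ ∏ q ∈ Q, q := by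
    intro ℓ hℓ hℓQ h
    obtain ⟨q, hq, hℓq⟩ := (Prime.dvd_finsetProd_iff hℓ.prime _).mp h
    exact hℓQ (((Nat.prime_dvd_prime_iff_eq hℓ (hQ q hq)).mp hℓq) ▸ hq)
  have hsq : ∀ q ∈ Q, ¬ q ^ 2 ∣ ∏ q' ∈ Q, q' := by
    intro q hq h
    rw [← Finset.mul_prod_erase Q (fun q' ↦ q') hq, pow_two] at h
    obtain ⟨q', hq', hqq'⟩ := (Prime.dvd_finsetProd_iff (hQ q hq).prime _).mp (Nat.dvd_of_mul_dvd_mul_left (hQ q hq).pos h)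
    exact Finset.ne_of_mem_erase hq' (((Nat.prime_dvd_prime_iff_eq (hQ q hq) (hQ q' (Finset.mem_of_mem_erase hq'))).mp hqq').symm)
  have hq₂ : ∀ q ∈ Q, Odd (W₂.LFunction q) := fun q hq ↦
    odd_LFunction_of_dvd_conductorNorm_eq_mul W₂ (hQ q hq) (hQN₁ q hq) (Finset.dvd_prod_of_mem _ hq) (hsq q hq) hN₂
  have hAS : ∀ ℓ ∈ S, ℓ ∉ Q → (2 : ℤ) ∣ W₁.LFunction ℓ - W₂.LFunction ℓ := fun ℓ hℓ hℓQ ↦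
    two_dvd_LFunction_sub_of_conductorNorm_eq_mul_coprime W₁ W₂ hN₂ (hS ℓ hℓ) (hdvdQ ℓ (hS ℓ hℓ) hℓQ) (hSN ℓ hℓ hℓQ)
  have hker' : ∀ y ∈ periodHomology (W₂.conductorNorm ℤ),
      (D₁.c : ℂ) * y F₁ / 2 ∈ D₁.L.lattice.toAddSubgroup ↔ (D₂.c : ℂ) * y D₂.f / 2 ∈ D₂.L.lattice.toAddSubgroup := by
    intro y hy
    rw [Submodule.mem_toAddSubgroup, Submodule.mem_toAddSubgroup, ← D₁.uniformize_eq_zero_iff, ← D₂.uniformize_eq_zero_iff]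
    exact hker y hy
  exact sameKernel_depleted_of_sameKernel_oldLines Q hQ hQN₁ hN₂ D₁.f D₂.f (fun n ↦ W₁.LFunction n) (fun n ↦ W₂.LFunction n)
    D₁.isNewformOf.2 D₂.isNewformOf.2 hT₁ hT₂ hq₁ hq₂ S hS hSodd hQS hAS N' hN' g₁ g₂ hg₁ hg₂ F₁ hF₁
    D₁.L.lattice.toAddSubgroup D₂.L.lattice.toAddSubgroup D₁.c D₂.c
    (fun z hz ↦ D₁.smul_periodLattice_le z hz) (fun z hz ↦ D₂.smul_periodLattice_le z hz) hker' x hx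

/-! ## §3 The inline cross-level stub of line `birth` on the shape `N(W₂) = N(W₁)·m`, `m` squarefree, from PLANE(2) at level `N(W₂)` + the KO parities -/

/-- **The body of v27's inline stub `hCopyNe` ON THE SHAPE `N(W₂) = N(W₁)·∏_{q∈Q} q`** (`Q` a set of primes not dividing `N(W₁)`), FROM `hPlane` — «for the
`m`-old line `F₁` (`a_n(F₁) = Σ_{T⊆Q}(∏T)·a_{n/∏T}(f₁)`) and every cycle `y ∈ H₁(X₀(N(W₂));ℤ)`: `u₁(c₁·y(F₁)/2) = O ↔ u₂(c₂·y(f₂)/2) = O`» — and `hKO` —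
«`a_q(W₁)` even for `q ∈ Q`» (Kraus–Oesterlé 1992 Prop. 3 at `p = 2`). `S`, `N'`, the old line and the other parities are discharged inside.
[cite: GreenbergVatsal2000, §3] [cite: KrausOesterle1992, Prop. 3 (p. 262–263)] [cite: CremonaAlgorithms1997, §2.4 and §2.10] -/
theorem sameDepletedKernel_conductorMulSquarefree_of_oldLinesPlane
    (hPlane : ∀ (W₁ : WeierstrassCurve ℚ) [W₁.IsElliptic] [W₁.IsGloballyMinimal]
      (W₂ : WeierstrassCurve ℚ) [W₂.IsElliptic] [W₂.IsGloballyMinimal],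
      IsOrdinaryAt W₁ 2 → IsOrdinaryAt W₂ 2 →
      (∀ x : ℚ, ¬ HasRationalTwoTorsionX W₁ x) → (∀ x : ℚ, ¬ HasRationalTwoTorsionX W₂ x) →
      ¬ IsSquare W₁.Δ → ¬ IsSquare W₂.Δ →
      (¬ ∃ (d : ℚ) (c : WeierstrassCurve.VariableChange ℚ), c • W₁.quadraticTwist d = W₂) →
      OnKilfordStratumAtTwo W₁ →
      ∀ (Q : Finset ℕ), (∀ q ∈ Q, q.Prime) → (∀ q ∈ Q, ¬ q ∣ W₁.conductorNorm ℤ) → W₂.conductorNorm ℤ = W₁.conductorNorm ℤ * ∏ q ∈ Q, q →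
      ∀ (F : Type) [Field F] [NumberField F], Module.finrank ℚ F = 3 →
      ∀ e₁ e₂ : F, aeval e₁ (twoDivisionUCubic W₁) = 0 → aeval e₂ (twoDivisionUCubic W₂) = 0 →
      AlignedAtTwo F e₁ e₂ → AlignedAtInfinity F (twoDivisionUCubic W₁) (twoDivisionUCubic W₂) e₁ e₂ →
      ∀ [NeZero (W₁.conductorNorm ℤ)] [NeZero (W₂.conductorNorm ℤ)]
        (D₁ : ModularParametrizationData W₁ (W₁.conductorNorm ℤ)) (D₂ : ModularParametrizationData W₂ (W₂.conductorNorm ℤ)),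
        Odd D₁.c → Odd D₂.c →
      ∀ (F₁ : CuspForm (Gamma0 (W₂.conductorNorm ℤ)) 2),
        (∀ n : ℕ, cuspCoeff F₁ n =
          ∑ T ∈ Q.powerset, ((∏ q ∈ T, q : ℕ) : ℂ) * (if (∏ q ∈ T, q) ∣ n then cuspCoeff D₁.f (n / ∏ q ∈ T, q) else 0)) →
      ∀ y ∈ periodHomology (W₂.conductorNorm ℤ),
        D₁.uniformize ((D₁.c : ℂ) * y F₁ / 2) = 0 ↔ D₂.uniformize ((D₂.c : ℂ) * y D₂.f / 2) = 0)
    (hKO : ∀ (W₁ : WeierstrassCurve ℚ) [W₁.IsElliptic] [W₁.IsGloballyMinimal]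
      (W₂ : WeierstrassCurve ℚ) [W₂.IsElliptic] [W₂.IsGloballyMinimal],
      IsOrdinaryAt W₁ 2 → IsOrdinaryAt W₂ 2 →
      (∀ x : ℚ, ¬ HasRationalTwoTorsionX W₁ x) → (∀ x : ℚ, ¬ HasRationalTwoTorsionX W₂ x) →
      ¬ IsSquare W₁.Δ → ¬ IsSquare W₂.Δ →
      ∀ (Q : Finset ℕ), (∀ q ∈ Q, q.Prime) → (∀ q ∈ Q, ¬ q ∣ W₁.conductorNorm ℤ) → W₂.conductorNorm ℤ = W₁.conductorNorm ℤ * ∏ q ∈ Q, q →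
      ∀ (F : Type) [Field F] [NumberField F], Module.finrank ℚ F = 3 →
      ∀ e₁ e₂ : F, aeval e₁ (twoDivisionUCubic W₁) = 0 → aeval e₂ (twoDivisionUCubic W₂) = 0 →
      ∀ q ∈ Q, Even (W₁.LFunction q)) :
    ∀ (W₁ : WeierstrassCurve ℚ) [W₁.IsElliptic] [W₁.IsGloballyMinimal]
      (W₂ : WeierstrassCurve ℚ) [W₂.IsElliptic] [W₂.IsGloballyMinimal],
      IsOrdinaryAt W₁ 2 → IsOrdinaryAt W₂ 2 →
      (∀ x : ℚ, ¬ HasRationalTwoTorsionX W₁ x) → (∀ x : ℚ, ¬ HasRationalTwoTorsionX W₂ x) →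
      ¬ IsSquare W₁.Δ → ¬ IsSquare W₂.Δ →
      (¬ ∃ (d : ℚ) (c : WeierstrassCurve.VariableChange ℚ), c • W₁.quadraticTwist d = W₂) →
      OnKilfordStratumAtTwo W₁ →
      ∀ (Q : Finset ℕ), (∀ q ∈ Q, q.Prime) → (∀ q ∈ Q, ¬ q ∣ W₁.conductorNorm ℤ) → W₂.conductorNorm ℤ = W₁.conductorNorm ℤ * ∏ q ∈ Q, q →
      ∀ (F : Type) [Field F] [NumberField F], Module.finrank ℚ F = 3 →
      ∀ e₁ e₂ : F, aeval e₁ (twoDivisionUCubic W₁) = 0 → aeval e₂ (twoDivisionUCubic W₂) = 0 →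
      AlignedAtTwo F e₁ e₂ → AlignedAtInfinity F (twoDivisionUCubic W₁) (twoDivisionUCubic W₂) e₁ e₂ →
      ∀ [NeZero (W₁.conductorNorm ℤ)] [NeZero (W₂.conductorNorm ℤ)]
        (D₁ : ModularParametrizationData W₁ (W₁.conductorNorm ℤ)) (D₂ : ModularParametrizationData W₂ (W₂.conductorNorm ℤ)),
        Odd D₁.c → Odd D₂.c →
      ∀ (N' : ℕ) [NeZero N'], N' = W₁.conductorNorm ℤ * W₂.conductorNorm ℤ *
          ∏ ℓ ∈ (W₁.conductorNorm ℤ * W₂.conductorNorm ℤ).primeFactors.erase 2, ℓ ^ 2 →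
      ∀ (g₁ g₂ : CuspForm (Gamma0 N') 2),
        (∀ n : ℕ, cuspCoeff g₁ n =
          if ∃ ℓ ∈ (W₁.conductorNorm ℤ * W₂.conductorNorm ℤ).primeFactors.erase 2, ℓ ∣ n then 0 else cuspCoeff D₁.f n) →
        (∀ n : ℕ, cuspCoeff g₂ n =
          if ∃ ℓ ∈ (W₁.conductorNorm ℤ * W₂.conductorNorm ℤ).primeFactors.erase 2, ℓ ∣ n then 0 else cuspCoeff D₂.f n) →
      ∀ x ∈ periodHomology N',
        D₁.uniformize ((D₁.c : ℂ) *
            ((((∏ ℓ ∈ (W₁.conductorNorm ℤ * W₂.conductorNorm ℤ).primeFactors.erase 2, ℓ ^ 2 : ℕ) : ℂ) * x g₁) / 2)) = 0 ↔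
          D₂.uniformize ((D₂.c : ℂ) *
            ((((∏ ℓ ∈ (W₁.conductorNorm ℤ * W₂.conductorNorm ℤ).primeFactors.erase 2, ℓ ^ 2 : ℕ) : ℂ) * x g₂) / 2)) = 0 := by
  intro W₁ _ _ W₂ _ _ hord₁ hord₂ ht₁ ht₂ hsq₁ hsq₂ htw hK Q hQ hQN₁ hN₂ F _ _ hF e₁ e₂ he₁ he₂ h2 hal _ _ D₁ D₂ hc₁ hc₂ N' _ hN' g₁ g₂ hg₁ hg₂
  classical
  set N₁ : ℕ := W₁.conductorNorm ℤ with hN₁def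
  set N₂ : ℕ := W₂.conductorNorm ℤ with hN₂def
  have hN₁0 : N₁ ≠ 0 := NeZero.ne _
  have hN₂0 : N₂ ≠ 0 := NeZero.ne _
  haveI : Fact (Nat.Prime 2) := ⟨Nat.prime_two⟩
  have h2N₂ : ¬ 2 ∣ N₂ := not_dvd_level_of_isNewformOf D₂.isNewformOf hord₂.1
  have hQ0 : ∀ q ∈ Q, q ≠ 0 := fun q hq ↦ (hQ q hq).ne_zero
  have hdvdQ : ∀ ℓ : ℕ, ℓ.Prime → ℓ ∉ Q → ¬ ℓ ∣ ∏ q ∈ Q, q := by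
    intro ℓ hℓ hℓQ h
    obtain ⟨q, hq, hℓq⟩ := (Prime.dvd_finsetProd_iff hℓ.prime _).mp h
    exact hℓQ (((Nat.prime_dvd_prime_iff_eq hℓ (hQ q hq)).mp hℓq) ▸ hq)
  set S : Finset ℕ := (N₁ * N₂).primeFactors.erase 2 with hS
  have hSp : ∀ ℓ ∈ S, ℓ.Prime := fun ℓ hℓ ↦ Nat.prime_of_mem_primeFactors (Finset.mem_of_mem_erase hℓ)
  have hSodd : ∀ ℓ ∈ S, Odd ℓ := fun ℓ hℓ ↦ (hSp ℓ hℓ).odd_of_ne_two (Finset.ne_of_mem_erase hℓ)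
  have hQS : Q ⊆ S := by
    intro q hq
    have hqN₂ : q ∣ N₂ := by rw [hN₂]; exact (Finset.dvd_prod_of_mem _ hq).mul_left N₁
    refine Finset.mem_erase.mpr ⟨fun h ↦ h2N₂ (h ▸ hqN₂), Nat.mem_primeFactors.mpr ⟨hQ q hq, hqN₂.mul_left N₁, mul_ne_zero hN₁0 hN₂0⟩⟩
  have hSN : ∀ ℓ ∈ S, ℓ ∉ Q → ℓ ∣ N₁ := by
    intro ℓ hℓ hℓQ
    have hℓ' := (Nat.mem_primeFactors.mp (Finset.mem_of_mem_erase hℓ)).2.1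
    rw [hN₂, ← mul_assoc] at hℓ'
    rcases (Nat.Prime.dvd_mul (hSp ℓ hℓ)).mp hℓ' with h | h
    · rcases (Nat.Prime.dvd_mul (hSp ℓ hℓ)).mp h with h | h <;> exact h
    · exact absurd h (hdvdQ ℓ (hSp ℓ hℓ) hℓQ)
  have hN'' : N₂ * ∏ ℓ ∈ S, ℓ ^ 2 ∣ N' := ⟨N₁, by rw [hN']; ring⟩
  -- the `m`-old line at level `N₂`
  obtain ⟨F₁, hF₁⟩ : ∃ F₁ : CuspForm (Gamma0 N₂) 2, ∀ n : ℕ, cuspCoeff F₁ n =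
      ∑ T ∈ Q.powerset, ((∏ q ∈ T, q : ℕ) : ℂ) * (if (∏ q ∈ T, q) ∣ n then cuspCoeff D₁.f (n / ∏ q ∈ T, q) else 0) :=
    exists_oldLines Q hQ0 (by rw [hN₂]) D₁.f
  exact uniformize_depleted_iff_of_oldLines_conductor D₁ D₂ Q hQ hQN₁ hN₂
    (hKO W₁ W₂ hord₁ hord₂ ht₁ ht₂ hsq₁ hsq₂ Q hQ hQN₁ hN₂ F hF e₁ e₂ he₁ he₂) S hSp hSodd hQS hSN N' hN'' g₁ g₂ hg₁ hg₂ F₁ hF₁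
    (hPlane W₁ W₂ hord₁ hord₂ ht₁ ht₂ hsq₁ hsq₂ htw hK Q hQ hQN₁ hN₂ F hF e₁ e₂ he₁ he₂ h2 hal D₁ D₂ hc₁ hc₂ F₁ hF₁)

end Summit.BirchSwinnertonDyer.BirchSwinnertonDyer.Theorems.AlignedTransportAtTwoKilfordCopyCrossLevelSquarefreeConductor

end
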